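import Mathlib.Analysis.InnerProductSpace.Completion
import Mathlib.Analysis.Normed.Module.Completion
import Mathlib.Analysis.Normed.Operator.Extend
import Mathlib.Topology.Sequences
import HarnessLib

/-!
# Closable symmetric forms: the completed form domain and its embedding (Kato VI §1.3–§1.4)

RH-FREE library file (abstract Hilbert-space operator theory; no number theory).

**Setting.** A symmetric form `𝔥 ≥ 0` given on a core is recorded as a (non-complete) inner product
space `V` — the core with the inner product `⟪f, g⟫_V = (𝔥 + 1)[f, g]` (Kato's pre-Hilbert space
`H_𝔥`, VI §1.3) — together with the inclusion `ι : V →L[ℂ] H` into the ambient Hilbert space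
(bounded because `‖f‖_H ≤ ‖f‖_𝔥`).  The candidate CLOSURE of the form lives on the completion
`UniformSpace.Completion V` (a Hilbert space, Mathlib), embedded into `H` by the extension
`formEmbedding ι` of `ι`; this is exactly the `(Q, J)` format of
`Literature/Analysis/OperatorTheory/CompactEmbeddingFormSpectrum` and of the first representation
theorem `Literature/Analysis/UnboundedOperators/ClosedFormOperator` (`formOperator J`), with
`Q = Completion V`, `J = formEmbedding ι` — PROVIDED `J` is injective.

**Kato VI Thm 1.17 (closability).** `J` is injective iff the form is closable in Kato's sense:
every `𝔥`-Cauchy sequence of the core that tends to `0` in `H` tends to `0` in `𝔥`-norm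
(`formEmbedding_injective_iff`).  A sufficient condition in the spirit of Kato VI Thm 1.16 is the
lower semicontinuity of the `𝔥`-norm along `H`-convergent sequences of the core
(`formEmbedding_injective_of_norm_le_of_tendsto`) — the form in which closability is available in
the tree for the Weil quadratic form (`ConnesConsaniMoscovici2025_prop_3_3_holds`, lsc).

## Main declarations (namespace `Literature.Analysis.UnboundedOperators`)

* `formEmbedding ι : Completion V →L[ℂ] H` — the extension of `ι` (ONE definition);
* `formEmbedding_coe`, `denseRange_formEmbedding`;
* `formEmbedding_injective_iff` — Kato VI Thm 1.17 in the `(V, ι)` format;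
* `formEmbedding_injective_of_norm_le_of_tendsto` — lsc ⟹ closable.

No named facts, no instances, no notation.

## References
* T. Kato, *Perturbation Theory for Linear Operators* (1966), VI §1.3 (the space `H_𝔥`, Thm 1.11),
  §1.4 Thms 1.16–1.17 (closed and closable forms), held text
  `book-kato1966-perturbation-theory-linear-operators` p0369–p0372. [Kato1966]
-/

noncomputable section

open UniformSpace Filter Topology

namespace Literature.Analysis.UnboundedOperators

variable {V : Type*} [NormedAddCommGroup V] [InnerProductSpace ℂ V]
variable {H : Type*} [NormedAddCommGroup H] [InnerProductSpace ℂ H] [CompleteSpace H]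

omit [InnerProductSpace ℂ V] in
/-- `V → Completion V` has dense range (as a bounded linear map). [cite: Kato1966, VI §1.4 Thm 1.17 (proof: «`H_t` is dense in `H_t̃`»), held p0371] -/
private theorem denseRange_toComplL [NormedSpace ℂ V] :
    DenseRange (Completion.toComplL : V →L[ℂ] Completion V) := by
  rw [Completion.coe_toComplL]; exact Completion.denseRange_coe

omit [InnerProductSpace ℂ V] in
/-- `V → Completion V` is uniformly inducing. [cite: Kato1966, VI §1.3 Thm 1.11, held p0369] -/
private theorem isUniformInducing_toComplL [NormedSpace ℂ V] :
    IsUniformInducing (Completion.toComplL : V →L[ℂ] Completion V) := by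
  rw [Completion.coe_toComplL]; exact Completion.isUniformInducing_coe V

/-- **The embedding `J : H_𝔥̃ → H` of the completed form domain**: the extension to
`Completion V` of the inclusion `ι : V →L[ℂ] H` of the core. [cite: Kato1966, VI §1.3 («`H_t` … the inner product `(u, v)_t`», Thm 1.11) and §1.4 Thm 1.17 (the closure `t̃` on the completion), held p0369–p0371] -/
def formEmbedding (ι : V →L[ℂ] H) : Completion V →L[ℂ] H :=
  ι.extend (Completion.toComplL : V →L[ℂ] Completion V)

variable (ι : V →L[ℂ] H)

/-- `J` extends `ι`: `J f = ι f` on the core. [cite: Kato1966, VI §1.4 Thm 1.17 («`t̃ ⊃ t`»), held p0371] -/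
@[simp] theorem formEmbedding_coe (f : V) : formEmbedding ι (f : Completion V) = ι f := by
  have h := ContinuousLinearMap.extend_eq ι denseRange_toComplL isUniformInducing_toComplL f
  rwa [Completion.coe_toComplL] at h

/-- `J` has dense range when the core is dense in `H`. [cite: Kato1966, VI §1.4 (densely defined forms), held p0371] -/
theorem denseRange_formEmbedding (hι : DenseRange ι) : DenseRange (formEmbedding ι) := by
  refine hι.mono ?_
  rintro _ ⟨f, rfl⟩
  exact ⟨(f : Completion V), formEmbedding_coe ι f⟩

/-- **Kato VI Thm 1.17 (closability) in the `(V, ι)` format: `J` is injective iff every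
`𝔥`-Cauchy sequence of the core with `ι u_n → 0` in `H` has `‖u_n‖_𝔥 → 0`.**
[cite: Kato1966, VI §1.4 Thm 1.17 («t is closable if and only if `u_n →_t 0` implies `t[u_n] → 0`»), held p0371] -/
theorem formEmbedding_injective_iff :
    Function.Injective (formEmbedding ι) ↔
      ∀ u : ℕ → V, CauchySeq u → Tendsto (fun n ↦ ι (u n)) atTop (𝓝 0) →
        Tendsto (fun n ↦ ‖u n‖) atTop (𝓝 0) := by
  constructor
  · intro hinj u hu h0
    -- the Cauchy sequence converges in the completion, to some `x` with `J x = 0`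
    have hc : CauchySeq (fun n ↦ (u n : Completion V)) :=
      (Completion.uniformContinuous_coe V).comp_cauchySeq hu
    obtain ⟨x, hx⟩ := cauchySeq_tendsto_of_complete hc
    have hJ : Tendsto (fun n ↦ formEmbedding ι (u n : Completion V)) atTop (𝓝 (formEmbedding ι x)) :=
      ((formEmbedding ι).continuous.tendsto x).comp hx
    simp only [formEmbedding_coe] at hJ
    have hx0 : x = 0 := hinj (by rw [tendsto_nhds_unique hJ h0, map_zero])
    rw [hx0] at hx
    have := (continuous_norm.tendsto (0 : Completion V)).comp hx
    simpa [Function.comp_def, Completion.norm_coe] using this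
  · intro hcl
    refine (injective_iff_map_eq_zero _).2 fun x hx ↦ ?_
    -- approximate `x` by core elements
    have hxc : x ∈ closure (Set.range ((↑) : V → Completion V)) := by
      rw [Completion.denseRange_coe.closure_range]; exact Set.mem_univ x
    obtain ⟨s, hs, hsx⟩ := mem_closure_iff_seq_limit.1 hxc
    choose u hu using hs
    have hsu : (fun n ↦ (u n : Completion V)) = s := funext hu
    have hu_c : CauchySeq u := by
      have h1 : CauchySeq s := hsx.cauchySeq
      rw [← hsu] at h1
      have h2 : Cauchy (map ((↑) : V → Completion V) (map u atTop)) := by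
        rw [Filter.map_map]; exact h1
      exact (Completion.isUniformInducing_coe V).cauchy_map_iff.1 h2
    have hu0 : Tendsto (fun n ↦ ι (u n)) atTop (𝓝 0) := by
      have hJ : Tendsto (fun n ↦ formEmbedding ι (s n)) atTop (𝓝 (formEmbedding ι x)) :=
        ((formEmbedding ι).continuous.tendsto x).comp hsx
      rw [hx] at hJ
      refine hJ.congr fun n ↦ ?_
      rw [← hu n, formEmbedding_coe]
    have hn := hcl u hu_c hu0
    -- `‖s n‖ = ‖u n‖ → 0`, so `s → 0`, so `x = 0`
    have hs0 : Tendsto s atTop (𝓝 0) := by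
      rw [tendsto_zero_iff_norm_tendsto_zero]
      refine hn.congr fun n ↦ ?_
      rw [← hu n, Completion.norm_coe]
    exact tendsto_nhds_unique hsx hs0

/-- **Lower semicontinuity ⟹ closability** (Kato VI Thms 1.16–1.17): if `𝔥`-norm balls of the core
are closed under `H`-convergence inside the core — `ι u_n → ι f` and `‖u_n‖_𝔥 ≤ C` force `‖f‖_𝔥 ≤ C`
— then the form is closable, i.e. `J` is injective.  (For `m` large, `u_m − u_n →_H u_m` as
`n → ∞` with `‖u_m − u_n‖_𝔥 ≤ ε`, whence `‖u_m‖_𝔥 ≤ ε`.)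
[cite: Kato1966, VI §1.4 Thm 1.16 («`u_n → u` and `{t[u_n]}` bounded. Then `u ∈ D(t)` and `Re t[u] ≤ lim inf Re t[u_n]`») and Thm 1.17, held p0370–p0371] -/
theorem formEmbedding_injective_of_norm_le_of_tendsto
    (hlsc : ∀ (u : ℕ → V) (f : V) (C : ℝ), Tendsto (fun n ↦ ι (u n)) atTop (𝓝 (ι f)) →
      (∀ n, ‖u n‖ ≤ C) → ‖f‖ ≤ C) :
    Function.Injective (formEmbedding ι) := by
  rw [formEmbedding_injective_iff]
  intro u hu h0
  rw [Metric.tendsto_atTop]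
  intro ε hε
  obtain ⟨N, hN⟩ := Metric.cauchySeq_iff.1 hu (ε / 2) (half_pos hε)
  refine ⟨N, fun m hm ↦ ?_⟩
  -- apply `hlsc` to `n ↦ u m − u (n + N)`, which tends to `u m` in `H`
  have ht : Tendsto (fun n ↦ ι (u m - u (n + N))) atTop (𝓝 (ι (u m))) := by
    have h1 : Tendsto (fun n ↦ ι (u (n + N))) atTop (𝓝 0) := h0.comp (tendsto_add_atTop_nat N)
    have h2 := (tendsto_const_nhds (x := ι (u m))).sub h1
    rw [sub_zero] at h2
    refine h2.congr fun n ↦ ?_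
    rw [map_sub]
  have hb : ∀ n, ‖u m - u (n + N)‖ ≤ ε / 2 := fun n ↦ by
    have := hN m hm (n + N) (Nat.le_add_left N n)
    rw [dist_eq_norm] at this
    exact this.le
  have hm' := hlsc (fun n ↦ u m - u (n + N)) (u m) (ε / 2) ht hb
  rw [dist_zero_right, norm_norm]
  linarith

end Literature.Analysis.UnboundedOperators

end
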